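import Summits.CriticalPhenomena.CardyFormulaZ2.Theorems.CardyFlipRussoQuadrupoleSelectionRuleBitsReduction
import HarnessLib

/-!
# Monotonicity in the exponent: `PairRate` is antitone, `ArmBudget` monotone in `θ`

Helper file for the informal kernel crux `QuadrupoleSelectionRule` (stmt-CriticalPhenomena-7029) of
route `CardyFlipRusso` (sub-problem `CardyFormulaZ2`), line `Sketch`, generation 4 (lead c2,
cycle 2), stubs W2a (`pairRate_anti`), W2b (`armBudget_mono`), W2c
(`bits_of_pairRate_armBudget_of_le`).  Vocabulary:
`Theorems/CardyFlipRussoQuadrupoleSelectionRuleDefs.lean` (namespace `…Theorems.BitsLeg`: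
`depth`, `cutoff`, `faceResponse`, `armWeight`, `PairRate`, `ArmBudget`,
`QuadrupoleSelectionRuleBits`); the reduction `bits_of_pairRate_armBudget` and the sign facts
`armWeight_nonneg`, `cutoff_nonneg` are in `…BitsReduction.lean`.

* W2a `pairRate_anti`: a pair rate at exponent `θ` is a pair rate at every `θ' ≤ θ`, with the
  same `C` and the layer constant `max C₀ 1`: beyond the (possibly thicker) layer the pairs are
  still beyond the old layer, and the base `δ / d` lies in `(0, 1]`, where `b ^ θ ≤ b ^ θ'`
  (`Real.rpow_le_rpow_of_exponent_ge`); the weights are nonnegative (`armWeight_nonneg`).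
* W2b `armBudget_mono`: an arm budget at exponent `θ` is an arm budget at every `θ' ≥ θ`, with
  the same `η`: the cut-off factor is `1` in the layer for both exponents and
  `(C₀ δ / d) ^ θ' ≤ (C₀ δ / d) ^ θ` beyond it (base in `(0, 1)`), see `cutoff_le_cutoff_of_le`;
  multiply by the nonnegative weights and sum.
* W2c `bits_of_pairRate_armBudget_of_le`: hence `PairRate θ₁` and `ArmBudget θ₂` with
  `θ₂ ≤ θ₁` already give the kernel on L5 in consumed form (`bits_of_pairRate_armBudget` at
  the exponent `θ₂`).
-/

noncomputable section

open Filter Topology Set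
open scoped BigOperators

namespace Summit.CriticalPhenomena.CardyFormulaZ2.Theorems.BitsLeg

open Literature.Probability.RandomPlanarGeometry

/-! ### The cut-off factor is antitone in the exponent -/

/-- Raising the exponent lowers the cut-off factor: `cutoff C₀ θ' δ d ≤ cutoff C₀ θ δ d` for
`θ ≤ θ'` when `C₀, δ > 0` (both are `1` in the layer `d ≤ C₀ δ`; beyond it the base
`C₀ δ / d` lies in `(0, 1)`). -/
theorem cutoff_le_cutoff_of_le {C₀ θ θ' δ : ℝ} (hC₀ : 0 < C₀) (hδ : 0 < δ) (hθ : θ ≤ θ')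
    (d : ℝ) : cutoff C₀ θ' δ d ≤ cutoff C₀ θ δ d := by
  unfold cutoff
  split_ifs with h
  · exact le_rfl
  · push Not at h
    have hd : 0 < d := lt_trans (mul_pos hC₀ hδ) h
    exact Real.rpow_le_rpow_of_exponent_ge (div_pos (mul_pos hC₀ hδ) hd)
      ((div_le_one hd).2 h.le) hθ

/-! ### W2a: the pair rate is antitone in the exponent -/

/-- **W2a.**  `PairRate` is antitone in the exponent: a pair rate at exponent `θ` is a pair rate
at every smaller exponent `θ' ≤ θ` (same `C`, layer constant `max C₀ 1`, so that the base
`δ / d` of the rate is at most `1` beyond the layer). -/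
theorem pairRate_anti : ∀ θ θ' : ℝ, θ' ≤ θ →
    Summit.CriticalPhenomena.CardyFormulaZ2.Theorems.BitsLeg.PairRate θ →
      Summit.CriticalPhenomena.CardyFormulaZ2.Theorems.BitsLeg.PairRate θ' := by
  intro θ θ' hθ hP R
  obtain ⟨C₀, hC₀, C, hC, hpair⟩ := hP R
  refine ⟨max C₀ 1, lt_of_lt_of_le hC₀ (le_max_left _ _), C, hC, ?_⟩
  intro δ hδ hδ1 t ht x hx
  have hx₀ : C₀ * δ < depth R δ x :=
    lt_of_le_of_lt (mul_le_mul_of_nonneg_right (le_max_left C₀ 1) hδ.le) hx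
  have hx₁ : δ < depth R δ x := by
    have h1 : 1 * δ ≤ max C₀ 1 * δ := mul_le_mul_of_nonneg_right (le_max_right C₀ 1) hδ.le
    rw [one_mul] at h1
    exact lt_of_le_of_lt h1 hx
  have hd : 0 < depth R δ x := lt_trans hδ hx₁
  have hb0 : 0 < δ / depth R δ x := div_pos hδ hd
  have hb1 : δ / depth R δ x ≤ 1 := (div_le_one hd).2 hx₁.le
  have hw : 0 ≤ armWeight R t δ (x, false) + armWeight R t δ (x, true) :=
    add_nonneg (armWeight_nonneg R t δ _) (armWeight_nonneg R t δ _)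
  calc |faceResponse R t δ (x, false) + faceResponse R t δ (x, true)|
      ≤ C * (δ / depth R δ x) ^ θ * (armWeight R t δ (x, false) + armWeight R t δ (x, true)) :=
        hpair δ hδ hδ1 t ht x hx₀
    _ ≤ C * (δ / depth R δ x) ^ θ' * (armWeight R t δ (x, false) + armWeight R t δ (x, true)) :=
        mul_le_mul_of_nonneg_right
          (mul_le_mul_of_nonneg_left (Real.rpow_le_rpow_of_exponent_ge hb0 hb1 hθ) hC) hw

/-! ### W2b: the arm budget is monotone in the exponent -/

/-- **W2b.**  `ArmBudget` is monotone in the exponent: an arm budget at exponent `θ` is an arm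
budget at every larger exponent `θ' ≥ θ`, with the same rate function `η` (the cut-off factor
only decreases, `cutoff_le_cutoff_of_le`, and the four-arm weights are nonnegative). -/
theorem armBudget_mono : ∀ θ θ' : ℝ, θ ≤ θ' →
    Summit.CriticalPhenomena.CardyFormulaZ2.Theorems.BitsLeg.ArmBudget θ →
      Summit.CriticalPhenomena.CardyFormulaZ2.Theorems.BitsLeg.ArmBudget θ' := by
  intro θ θ' hθ hA R C₀ hC₀
  obtain ⟨η, hη, hbudget⟩ := hA R C₀ hC₀
  refine ⟨η, hη, fun δ hδ hδ1 t ht => ?_⟩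
  calc ∑ k ∈ faces R δ, cutoff C₀ θ' δ (depth R δ k.1) * armWeight R t δ k
      ≤ ∑ k ∈ faces R δ, cutoff C₀ θ δ (depth R δ k.1) * armWeight R t δ k :=
        Finset.sum_le_sum fun k _ =>
          mul_le_mul_of_nonneg_right (cutoff_le_cutoff_of_le hC₀ hδ hθ _)
            (armWeight_nonneg R t δ k)
    _ ≤ η δ := hbudget δ hδ hδ1 t ht

/-! ### W2c: the reduction with two exponents -/

/-- **W2c.**  A pair rate at exponent `θ₁` and an arm budget at any exponent `θ₂ ≤ θ₁` give the
kernel crux on L5 in consumed form: lower the pair rate to `θ₂` (`pairRate_anti`) and apply the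
reduction `bits_of_pairRate_armBudget` at `θ₂`. -/
theorem bits_of_pairRate_armBudget_of_le : ∀ θ₁ θ₂ : ℝ, θ₂ ≤ θ₁ →
    Summit.CriticalPhenomena.CardyFormulaZ2.Theorems.BitsLeg.PairRate θ₁ →
      Summit.CriticalPhenomena.CardyFormulaZ2.Theorems.BitsLeg.ArmBudget θ₂ →
        Summit.CriticalPhenomena.CardyFormulaZ2.Theorems.BitsLeg.QuadrupoleSelectionRuleBits :=
  fun θ₁ θ₂ hθ hP hA => bits_of_pairRate_armBudget θ₂ (pairRate_anti θ₁ θ₂ hθ hP) hA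

end Summit.CriticalPhenomena.CardyFormulaZ2.Theorems.BitsLeg

end
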